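import Summits.HodgeConjecture.HodgeConjecture.Theses.HeckePrymWeil
import Summits.HodgeConjecture.HodgeConjecture.Theorems.HeckePrymWeilWeilSixfoldsSqrtMinus7OneClassSufficesLemmas
import Summits.HodgeConjecture.HodgeConjecture.Theorems.WeilSixfoldsSqrtMinus7.Negative.EigenvalueSeparation
import Literature.AlgebraicGeometry.Motives.AbelianVarietyCohomologyExteriorH1
import Literature.AlgebraicGeometry.HodgeTheory.AbelianVarietyEndomorphismsHOne
import Literature.AlgebraicGeometry.HodgeTheory.WeilClassesCyclicPrymTyping
import HarnessLib

/-!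
# Route HeckePrymWeil · crux `WeilSixfoldsSqrtMinus7` (stmt-HodgeConjecture-1260) · line
# `real-quadratic-base-change` · stub `stub_oneClassSuffices` — part 2/3: the joint eigenlines

On a complex abelian 12-fold `B` with two COMMUTING endomorphisms `ψ_K² = -7`, `ψ_F² = t`
(`t > 0` non-square), i.e. multiplication by the CM field `L = ℚ(√-7, √t)`:

* `H¹` (`exists_jointEigenbasis_one`): `ψ_K^*`, `ψ_F^*` commute with `(ψ_K^*)² = -7`, `(ψ_F^*)² = t`
  and have RATIONAL traces (`trace_map_one_mem_range_ratCast`), so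
  `tr ψ_K^* ∈ ℚ ∩ i√7 ℤ = 0`, `tr ψ_F^* ∈ ℚ ∩ √t ℤ = 0`, `tr ψ_K^*ψ_F^* ∈ ℚ ∩ i√(7t) ℤ = 0`; the four
  joint eigenspaces `V_{±,±}` of `(ψ_K^*, ψ_F^*)` on `H¹ ≅ ℂ²⁴` (`b₁ = 2 dim B`,
  `AbelianVariety.finrank_complexBetti_one`) have dimension `6` each and `H¹` has a joint
  eigenbasis (part 1/3, `oneClassSuffices_adaptedBasis`) — "`H¹(B, ℚ)` is free of rank `6` over `L`".
* `H⁶ = ⋀⁶ H¹` (`AbelianVariety.hasExteriorCohomologyH1_complexPoints`; head theorem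
  `oneClassSuffices_jointEigenline`, a registered sub-goal of the crux item): the wedge basis
  `⌣_{i∈S} bᵢ` diagonalises `T_K = (𝟙+ψ_K)^*`, `T_F = (𝟙+ψ_F)^*` with characters `∏ (1 ± i√7)`,
  `∏ (1 ± √t)`; by eigenvalue separation (`Negative.mixed_ne_one_add_pow_six`;
  `one_add_pow_mul_one_sub_pow_ne_of_real`, where `t ≠ 1` is used) the joint eigenspace of
  `(T_K, T_F)` for `((1 + ε i√7)⁶, (1 + ε' √t)⁶)` is the LINE `⋀⁶ V_{ε,ε'}` (van Geemen, proof of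
  Thm. 6.12: the invariant subspaces `⋀ᵃ W ⊗ ⋀ᵇ W^*`).

Everything is a theorem; no definition, no named fact.
-/

noncomputable section

-- single-problem summit (Problem = Summit): the mandated namespace repeats `HodgeConjecture`.
set_option linter.dupNamespace false

open CategoryTheory
open Literature.AlgebraicGeometry.Motives Literature.AlgebraicGeometry.HodgeTheory
open Literature.AlgebraicGeometry.Motives.AbelianVariety
open Literature.AlgebraicTopology.SingularHomology

namespace Summit.HodgeConjecture.HodgeConjecture.Theorems.WeilSixfoldsSqrtMinus7.RealQuadraticBaseChange

open Summit.HodgeConjecture.HodgeConjecture.Theorems.WeilSixfoldsSqrtMinus7.Negative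
  (I_mul_sqrt_seven_sq mixed_ne_one_add_pow_six ne_zero_of_sq)

/-! ### `H¹(B(ℂ); ℂ)`: the joint eigenbasis of `(ψ_K^*, ψ_F^*)` -/

section HOne

variable {B : AbelianVariety ℂ}

/-- `(f ≫ g)^* = f^* ∘ g^*` on `Hᵏ(B(ℂ); ℂ)`, element form. [folklore] -/
theorem complexBetti_map_comp_apply (f g : B ⟶ B) (k : ℕ) (c : complexBetti B.X k) :
    complexBetti.map (f ≫ g).hom.hom.hom k c =
      complexBetti.map f.hom.hom.hom k (complexBetti.map g.hom.hom.hom k c) := by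
  change complexBetti.map (f.hom.hom.hom ≫ g.hom.hom.hom) k c = _
  rw [complexBetti.map_comp]
  rfl

/-- **`(ψ^*)² = n` on `H¹`** for `ψ ≫ ψ = n • 𝟙` (`n : ℤ`; additivity of `f ↦ f^*|_{H¹}`,
`complexBetti_map_zsmul_one`). [cite: vanGeemen1994HodgeAV, 4.8–4.9] -/
theorem map_map_one_of_comp_self_eq_zsmul {ψ : B ⟶ B} {n : ℤ} (h : ψ ≫ ψ = n • 𝟙 B)
    (c : complexBetti B.X 1) :
    complexBetti.map ψ.hom.hom.hom 1 (complexBetti.map ψ.hom.hom.hom 1 c) = (n : ℂ) • c := by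
  rw [← complexBetti_map_comp_apply, h, complexBetti_map_zsmul_one]
  change ((n • complexBetti.map (𝟙 B : B ⟶ B).hom.hom.hom 1).hom) c = _
  rw [ModuleCat.hom_zsmul, LinearMap.smul_apply]
  change n • complexBetti.map (𝟙 B.X) 1 c = _
  rw [complexBetti.map_id]
  change n • c = _
  rw [Int.cast_smul_eq_zsmul]

/-- **The joint eigenbasis of `H¹(B(ℂ); ℂ)` for `(ψ_K^*, ψ_F^*)`.** On a complex abelian 12-fold
with commuting `ψ_K² = -7`, `ψ_F² = t` (`t > 0` non-square), `H¹(B(ℂ); ℂ) ≅ ℂ²⁴` has a basis `b` of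
joint eigenvectors, `ψ_K^* bⱼ = ε_K(j) i√7 · bⱼ`, `ψ_F^* bⱼ = ε_F(j) √t · bⱼ` (`ε = ±1`), in which
each of the four sign patterns occurs at most `6` times — i.e. `H¹(B, ℚ)` is free of rank `6` over
`L = ℚ(√-7, √t)`: the three traces `tr ψ_K^*`, `tr ψ_F^*`, `tr ψ_K^*ψ_F^*` are rational
(`trace_map_one_mem_range_ratCast`) integer multiples of `i√7`, `√t`, `i√7√t`, hence `0`, and the
joint idempotents then have trace `24/4` (`oneClassSuffices_adaptedBasis`).
[cite: vanGeemen1994HodgeAV, 4.8–4.9 and proof of Lemma 5.2] -/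
theorem exists_jointEigenbasis_one (ψK ψF : B ⟶ B) (t : ℕ) (hB : B.dim = 12)
    (hK : ψK ≫ ψK = -((7 : ℤ) • 𝟙 B)) (hF : ψF ≫ ψF = (t : ℤ) • 𝟙 B) (hKF : ψK ≫ ψF = ψF ≫ ψK)
    (ht : 0 < t) (hsq : ¬ IsSquare t) :
    ∃ (b : Module.Basis (Fin (4 * 6)) ℂ (complexBetti B.X 1)) (εK εF : Fin (4 * 6) → ℂ),
      (∀ j, εK j = 1 ∨ εK j = -1) ∧ (∀ j, εF j = 1 ∨ εF j = -1) ∧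
      (∀ j, complexBetti.map ψK.hom.hom.hom 1 (b j) =
        (εK j * (Complex.I * (Real.sqrt (7 : ℝ) : ℂ))) • b j) ∧
      (∀ j, complexBetti.map ψF.hom.hom.hom 1 (b j) = (εF j * (Real.sqrt (t : ℝ) : ℂ)) • b j) ∧
      ∀ ε ε' : ℂ, (Finset.univ.filter fun j => εK j = ε ∧ εF j = ε').card ≤ 6 := by
  haveI := finite_complexBetti_abelianVariety B 1
  set s : ℂ := Complex.I * (Real.sqrt (7 : ℝ) : ℂ) with hs_def
  set r : ℂ := (Real.sqrt (t : ℝ) : ℂ) with hr_def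
  set K₁ : Module.End ℂ (complexBetti B.X 1) := (complexBetti.map ψK.hom.hom.hom 1).hom with hK₁
  set F₁ : Module.End ℂ (complexBetti B.X 1) := (complexBetti.map ψF.hom.hom.hom 1).hom with hF₁
  have hs2 : s ^ 2 = -7 := I_mul_sqrt_seven_sq
  have hs0 : s ≠ 0 := ne_zero_of_sq hs2
  have ht0 : (0 : ℝ) < Real.sqrt (t : ℝ) := Real.sqrt_pos.2 (by exact_mod_cast ht)
  have hr0 : r ≠ 0 := by
    rw [hr_def, Ne, Complex.ofReal_eq_zero]
    exact ht0.ne'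
  have hr2 : r ^ 2 = t := by
    rw [hr_def, ← Complex.ofReal_pow, Real.sq_sqrt (Nat.cast_nonneg _), Complex.ofReal_natCast]
  -- the relations `K₁² = s²`, `F₁² = r²`, `K₁ F₁ = F₁ K₁`
  have hK' : ψK ≫ ψK = -((7 : ℕ) • 𝟙 B) := by rw [hK, ← natCast_zsmul]; rfl
  have hKK : K₁ * K₁ = (s ^ 2) • (1 : Module.End ℂ (complexBetti B.X 1)) := by
    refine LinearMap.ext fun c => ?_
    rw [Module.End.mul_apply, LinearMap.smul_apply, Module.End.one_apply, hs2, neg_smul]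
    exact complexBetti_map_map_one_of_comp_self hK' c
  have hFF : F₁ * F₁ = (r ^ 2) • (1 : Module.End ℂ (complexBetti B.X 1)) := by
    refine LinearMap.ext fun c => ?_
    rw [Module.End.mul_apply, LinearMap.smul_apply, Module.End.one_apply, hr2]
    have h := map_map_one_of_comp_self_eq_zsmul hF c
    rwa [Int.cast_natCast] at h
  have hKF₁ : K₁ * F₁ = F₁ * K₁ := by
    refine LinearMap.ext fun c => ?_
    change complexBetti.map ψK.hom.hom.hom 1 (complexBetti.map ψF.hom.hom.hom 1 c) =
      complexBetti.map ψF.hom.hom.hom 1 (complexBetti.map ψK.hom.hom.hom 1 c)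
    rw [← complexBetti_map_comp_apply, ← complexBetti_map_comp_apply, hKF]
  -- the three traces vanish
  have htK : LinearMap.trace ℂ _ K₁ = 0 := by
    obtain ⟨m, hm⟩ := exists_int_trace_eq_mul_of_mul_self hs0 hKK
    obtain ⟨q, hq⟩ := trace_map_one_mem_range_ratCast ψK
    rw [← hK₁, hm, hs_def] at hq
    rw [hm, int_eq_zero_of_ratCast_eq_I_mul (x := Real.sqrt (7 : ℝ)) (Real.sqrt_pos.2 (by norm_num))
      hq, Int.cast_zero, mul_zero]
  have htF : LinearMap.trace ℂ _ F₁ = 0 := by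
    obtain ⟨m, hm⟩ := exists_int_trace_eq_mul_of_mul_self hr0 hFF
    obtain ⟨q, hq⟩ := trace_map_one_mem_range_ratCast ψF
    rw [← hF₁, hm, hr_def] at hq
    rw [hm, int_eq_zero_of_ratCast_eq_sqrt_mul hsq hq, Int.cast_zero, mul_zero]
  have htKF : LinearMap.trace ℂ _ (K₁ * F₁) = 0 := by
    have hsq2 : (K₁ * F₁) * (K₁ * F₁) = ((s * r) ^ 2) • (1 : Module.End ℂ (complexBetti B.X 1)) := by
      calc (K₁ * F₁) * (K₁ * F₁) = K₁ * (F₁ * K₁) * F₁ := by simp only [mul_assoc]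
        _ = (K₁ * K₁) * (F₁ * F₁) := by rw [← hKF₁]; simp only [mul_assoc]
        _ = ((s * r) ^ 2) • 1 := by rw [hKK, hFF, smul_mul_smul_comm, one_mul, ← mul_pow]
    obtain ⟨m, hm⟩ := exists_int_trace_eq_mul_of_mul_self (mul_ne_zero hs0 hr0) hsq2
    obtain ⟨q, hq⟩ := trace_map_one_mem_range_ratCast (ψK ≫ ψF)
    have e : (complexBetti.map (ψK ≫ ψF).hom.hom.hom 1).hom = K₁ * F₁ :=
      LinearMap.ext fun c => complexBetti_map_comp_apply ψK ψF 1 c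
    rw [e, hm, hs_def, hr_def] at hq
    have hq' : (q : ℂ) = Complex.I * ((Real.sqrt (7 : ℝ) * Real.sqrt (t : ℝ) : ℝ) : ℂ) * m := by
      rw [hq]; push_cast; ring
    rw [hm, int_eq_zero_of_ratCast_eq_I_mul (mul_pos (Real.sqrt_pos.2 (by norm_num)) ht0) hq',
      Int.cast_zero, mul_zero]
  -- the involutions `κ = K₁/s`, `φ = F₁/r`
  have hκ := inv_smul_mul_inv_smul_eq_one hs0 hKK
  have hφ := inv_smul_mul_inv_smul_eq_one hr0 hFF
  have hκφ : (s⁻¹ • K₁) * (r⁻¹ • F₁) = (r⁻¹ • F₁) * (s⁻¹ • K₁) := by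
    rw [smul_mul_smul_comm, smul_mul_smul_comm, hKF₁, mul_comm s⁻¹]
  have htκ : LinearMap.trace ℂ _ (s⁻¹ • K₁) = 0 := by rw [map_smul, htK, smul_zero]
  have htφ : LinearMap.trace ℂ _ (r⁻¹ • F₁) = 0 := by rw [map_smul, htF, smul_zero]
  have htκφ : LinearMap.trace ℂ _ ((s⁻¹ • K₁) * (r⁻¹ • F₁)) = 0 := by
    rw [smul_mul_smul_comm, map_smul, htKF, smul_zero]
  have hdim : Module.finrank ℂ (complexBetti B.X 1) = 4 * 6 := by
    rw [AbelianVariety.finrank_complexBetti_one, hB]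
  obtain ⟨b, εK, εF, hεK, hεF, hKb, hFb, hcount⟩ :=
    oneClassSuffices_adaptedBasis hκ hφ hκφ htκ htφ htκφ hdim
  refine ⟨b, εK, εF, hεK, hεF, fun j => ?_, fun j => ?_, hcount⟩
  · have h := hKb j
    rw [LinearMap.smul_apply] at h
    calc complexBetti.map ψK.hom.hom.hom 1 (b j) = s • (s⁻¹ • K₁ (b j)) := by
          rw [smul_smul, mul_inv_cancel₀ hs0, one_smul]
      _ = (εK j * s) • b j := by rw [h, smul_smul, mul_comm]
  · have h := hFb j
    rw [LinearMap.smul_apply] at h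
    calc complexBetti.map ψF.hom.hom.hom 1 (b j) = r • (r⁻¹ • F₁ (b j)) := by
          rw [smul_smul, mul_inv_cancel₀ hr0, one_smul]
      _ = (εF j * r) • b j := by rw [h, smul_smul, mul_comm]

end HOne

/-! ### `H⁶ = ⋀⁶ H¹`: the joint eigenspaces of `(𝟙+ψ_K)^*`, `(𝟙+ψ_F)^*` for `((1+μ)⁶, (1+ν)⁶)`
are lines -/

section Wedge

variable {B : AbelianVariety ℂ}

/-- `(𝟙 + ψ)^* c = c + ψ^* c` on `H¹` (additivity of the action on `H¹`).
[cite: vanGeemen1994HodgeAV, 4.8–4.9] -/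
theorem complexBetti_map_id_add_one (ψ : B ⟶ B) (c : complexBetti B.X 1) :
    complexBetti.map (𝟙 B + ψ).hom.hom.hom 1 c = c + complexBetti.map ψ.hom.hom.hom 1 c := by
  rw [complexBetti_map_add_one]
  change ((complexBetti.map (𝟙 B : B ⟶ B).hom.hom.hom 1 + complexBetti.map ψ.hom.hom.hom 1).hom) c =
    _
  rw [ModuleCat.hom_add, LinearMap.add_apply]
  change complexBetti.map (𝟙 B.X) 1 c + complexBetti.map ψ.hom.hom.hom 1 c = _
  rw [complexBetti.map_id]
  rfl

/-- A sign times a sign: `ε₁ s ∈ {ε₂ s, -(ε₂ s)}` for `ε₁, ε₂ = ±1`. [folklore] -/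
theorem sign_mul_eq_or (s : ℂ) {ε₁ ε₂ : ℂ} (h₁ : ε₁ = 1 ∨ ε₁ = -1) (h₂ : ε₂ = 1 ∨ ε₂ = -1) :
    ε₁ * s = ε₂ * s ∨ ε₁ * s = -(ε₂ * s) := by
  rcases h₁ with rfl | rfl <;> rcases h₂ with rfl | rfl
  · exact Or.inl rfl
  · exact Or.inr (by ring)
  · exact Or.inr (by ring)
  · exact Or.inl rfl

/-- If `∏ᵢ (1 + λᵢ) = (1 + μ)⁶` over six values `λᵢ ∈ {μ, -μ}` and the mixed products
`(1 + μ)ᵃ (1 - μ)ᵇ`, `b ≥ 1`, all differ from `(1 + μ)⁶`, then every `λᵢ = μ`. [folklore] -/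
theorem forall_eq_of_prod_one_add_eq {μ : ℂ} (lam : Fin 6 → ℂ) (hlam : ∀ i, lam i = μ ∨ lam i = -μ)
    (hsep : ∀ a b : ℕ, a + b = 6 → b ≠ 0 → (1 + μ) ^ a * (1 - μ) ^ b ≠ (1 + μ) ^ 6)
    (h : ∏ i, (1 + lam i) = (1 + μ) ^ 6) : ∀ i, lam i = μ := by
  classical
  have hp := prod_add_mul_eq_pow_mul_pow lam hlam 1 1
  simp only [one_mul] at hp
  rw [hp] at h
  have hb : (Finset.univ.filter fun i : Fin 6 => ¬ lam i = μ).card = 0 := by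
    by_contra hb
    exact hsep _ _ (card_filter_add_card_filter_not_eq lam) hb h
  intro i
  have hi := Finset.filter_eq_empty_iff.1 (Finset.card_eq_zero.1 hb) (Finset.mem_univ i)
  exact not_not.1 hi

/-- **The joint eigenspace of `(𝟙+ψ_K)^*`, `(𝟙+ψ_F)^*` on `H⁶(B(ℂ); ℂ)` for `((1 + μ)⁶, (1 + ν)⁶)`,
`μ = ± i√7`, `ν = ±√t`, lies in a LINE** (it is `⋀⁶ V_{μ,ν}` for the `6`-dimensional joint
eigenspace `V_{μ,ν} ⊆ H¹`). Proof: in the joint eigenbasis `b` of `H¹` (`exists_jointEigenbasis_one`)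
the wedge basis `⌣_{i∈S} bᵢ`, `|S| = 6`, of `H⁶ = ⋀⁶ H¹` (Mathlib `Basis.exteriorPower` transported
along `wedgeToCup`, bijective by `AbelianVariety.hasExteriorCohomologyH1_complexPoints`)
diagonalises both operators, with characters `∏_{i∈S} (1 + ε_K(i) i√7)`, `∏_{i∈S} (1 + ε_F(i)√t)`
(`map_cupPowOne`, multilinearity); a joint eigenvector is a combination of the `S` with matching
characters (`forall_apply_eq_smul_iff_mem_span_image`); matching forces all six `bᵢ`, `i ∈ S`, into
`V_{μ,ν}` (eigenvalue separation: `Negative.mixed_ne_one_add_pow_six` for `μ² = -7`,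
`one_add_pow_mul_one_sub_pow_ne_of_real` for the real `ν ≠ 0, -1` — here `t` non-square is used),
and at most `6` basis vectors lie there, so at most one `S` matches.
[cite: vanGeemen1994HodgeAV, proof of Thm. 6.12 and of Lemma 5.2 (6)] -/
theorem oneClassSuffices_jointEigenline :
    ∀ {B : AbelianVariety ℂ} (ψK ψF : B ⟶ B) (t : ℕ), B.dim = 12 → ψK ≫ ψK = -((7 : ℤ) • 𝟙 B) →
      ψF ≫ ψF = (t : ℤ) • 𝟙 B → ψK ≫ ψF = ψF ≫ ψK → 0 < t → ¬ IsSquare t → ∀ {μ ν : ℂ},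
      (μ = Complex.I * (Real.sqrt (7 : ℝ) : ℂ) ∨ μ = -(Complex.I * (Real.sqrt (7 : ℝ) : ℂ))) →
      (ν = (Real.sqrt (t : ℝ) : ℂ) ∨ ν = -(Real.sqrt (t : ℝ) : ℂ)) →
      ∃ w : complexBetti B.X 6,
        Module.End.eigenspace (complexBetti.map (𝟙 B + ψK).hom.hom.hom 6).hom ((1 + μ) ^ 6) ⊓
            Module.End.eigenspace (complexBetti.map (𝟙 B + ψF).hom.hom.hom 6).hom ((1 + ν) ^ 6) ≤
          ℂ ∙ w := by
  intro B ψK ψF t hB hK hF hKF ht hsq μ ν hμ hν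
  classical
  obtain ⟨b, εK, εF, hεK, hεF, hKb, hFb, hcount⟩ :=
    exists_jointEigenbasis_one ψK ψF t hB hK hF hKF ht hsq
  set s : ℂ := Complex.I * (Real.sqrt (7 : ℝ) : ℂ) with hs_def
  set r : ℂ := (Real.sqrt (t : ℝ) : ℂ) with hr_def
  have hs2 : s ^ 2 = -7 := I_mul_sqrt_seven_sq
  have hs0 : s ≠ 0 := ne_zero_of_sq hs2
  have ht0 : (0 : ℝ) < Real.sqrt (t : ℝ) := Real.sqrt_pos.2 (by exact_mod_cast ht)
  have hr0 : r ≠ 0 := by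
    rw [hr_def, Ne, Complex.ofReal_eq_zero]
    exact ht0.ne'
  -- the signs of `μ = εμ s`, `ν = εν r`
  obtain ⟨εμ, hεμ, rfl⟩ : ∃ ε : ℂ, (ε = 1 ∨ ε = -1) ∧ μ = ε * s := by
    rcases hμ with rfl | rfl
    · exact ⟨1, Or.inl rfl, by rw [one_mul]⟩
    · exact ⟨-1, Or.inr rfl, by rw [neg_one_mul]⟩
  obtain ⟨εν, hεν, rfl⟩ : ∃ ε : ℂ, (ε = 1 ∨ ε = -1) ∧ ν = ε * r := by
    rcases hν with rfl | rfl
    · exact ⟨1, Or.inl rfl, by rw [one_mul]⟩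
    · exact ⟨-1, Or.inr rfl, by rw [neg_one_mul]⟩
  -- separation of the characters
  have hsepK : ∀ a b : ℕ, a + b = 6 → b ≠ 0 →
      (1 + εμ * s) ^ a * (1 - εμ * s) ^ b ≠ (1 + εμ * s) ^ 6 :=
    fun a b hab hb => mixed_ne_one_add_pow_six (by rcases hεμ with rfl | rfl <;> simp [hs2]) hab hb
  have hsepF : ∀ a b : ℕ, a + b = 6 → b ≠ 0 →
      (1 + εν * r) ^ a * (1 - εν * r) ^ b ≠ (1 + εν * r) ^ 6 := by
    obtain ⟨ρ, hρ0, hρ1, hρ⟩ : ∃ ρ : ℝ, ρ ≠ 0 ∧ 1 + ρ ≠ 0 ∧ εν * r = (ρ : ℂ) := by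
      rcases hεν with rfl | rfl
      · exact ⟨Real.sqrt t, ht0.ne', by positivity, by rw [one_mul]⟩
      · refine ⟨-Real.sqrt t, neg_ne_zero.2 ht0.ne', fun h => hsq ?_, ?_⟩
        swap
        · rw [hr_def]; push_cast; ring
        have h1 : Real.sqrt (t : ℝ) = 1 := by linarith
        rw [Real.sqrt_eq_one] at h1
        have h1' : t = 1 := by exact_mod_cast h1
        rw [h1']
        exact ⟨1, rfl⟩
    intro a b hab hb
    rw [hρ]
    exact one_add_pow_mul_one_sub_pow_ne_of_real hρ0 hρ1 hab hb
  -- `(𝟙 + ψ)^*` on the joint eigenbasis of `H¹`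
  have hT1K : ∀ j, complexBetti.map (𝟙 B + ψK).hom.hom.hom 1 (b j) = (1 + εK j * s) • b j :=
      fun j => by
    rw [complexBetti_map_id_add_one, hKb, add_smul, one_smul]
  have hT1F : ∀ j, complexBetti.map (𝟙 B + ψF).hom.hom.hom 1 (b j) = (1 + εF j * r) • b j :=
      fun j => by
    rw [complexBetti_map_id_add_one, hFb, add_smul, one_smul]
  -- the wedge basis of `H⁶` and the diagonal action
  have hΛ := AbelianVariety.hasExteriorCohomologyH1_complexPoints B
  let Bw : Module.Basis (Set.powersetCard (Fin (4 * 6)) 6) ℂ (complexBetti B.X 6) :=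
    (b.exteriorPower 6).map (hΛ.equiv 6)
  have hBw : ∀ S, Bw S =
      cupPowOne ℂ (ComplexPoints B.X) 6 (b ∘ (Set.powersetCard.ofFinEmbEquiv.symm S)) := by
    intro S
    change hΛ.equiv 6 ((b.exteriorPower 6) S) = _
    rw [exteriorPower.basis_apply, HasExteriorCohomologyH1.equiv_apply, exteriorPower.ιMulti_family,
      wedgeToCup_ιMulti]
  have hact : ∀ (ψ : B ⟶ B) (η : Fin (4 * 6) → ℂ),
      (∀ j, complexBetti.map (𝟙 B + ψ).hom.hom.hom 1 (b j) = η j • b j) →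
      ∀ S, (complexBetti.map (𝟙 B + ψ).hom.hom.hom 6).hom (Bw S) =
        (∏ i : Fin 6, η (Set.powersetCard.ofFinEmbEquiv.symm S i)) • Bw S := by
    intro ψ η hη S
    rw [hBw]
    change singularCohomology.map ℂ ℂ (AlgPoints.mapContinuous (L := ℂ) (𝟙 B + ψ).hom.hom.hom) 6
      (cupPowOne ℂ _ 6 _) = _
    rw [map_cupPowOne]
    have e : (fun i => singularCohomology.map ℂ ℂ
        (AlgPoints.mapContinuous (L := ℂ) (𝟙 B + ψ).hom.hom.hom) 1
          ((b ∘ (Set.powersetCard.ofFinEmbEquiv.symm S)) i)) =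
        fun i => η (Set.powersetCard.ofFinEmbEquiv.symm S i) •
          (b ∘ (Set.powersetCard.ofFinEmbEquiv.symm S)) i := by
      funext i
      exact hη _
    rw [e, MultilinearMap.map_smul_univ]
  have hactK := hact ψK (fun j => 1 + εK j * s) hT1K
  have hactF := hact ψF (fun j => 1 + εF j * r) hT1F
  -- both operators, indexed by `Bool` (`true ↦ K`, `false ↦ F`)
  let T : Bool → (complexBetti B.X 6 →ₗ[ℂ] complexBetti B.X 6) := fun p =>
    cond p (complexBetti.map (𝟙 B + ψK).hom.hom.hom 6).hom
      (complexBetti.map (𝟙 B + ψF).hom.hom.hom 6).hom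
  let cS : Set.powersetCard (Fin (4 * 6)) 6 → Bool → ℂ := fun S p =>
    cond p (∏ i : Fin 6, (1 + εK (Set.powersetCard.ofFinEmbEquiv.symm S i) * s))
      (∏ i : Fin 6, (1 + εF (Set.powersetCard.ofFinEmbEquiv.symm S i) * r))
  have hT : ∀ p S, T p (Bw S) = cS S p • Bw S := by
    rintro (_ | _) S
    · exact hactF S
    · exact hactK S
  let χ : Bool → ℂ := fun p => cond p ((1 + εμ * s) ^ 6) ((1 + εν * r) ^ 6)
  -- a matching `S` consists of the (at most six) indices of pattern `(εμ, εν)`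
  have hkey : ∀ S, cS S = χ →
      (S : Finset (Fin (4 * 6))) = Finset.univ.filter (fun j => εK j = εμ ∧ εF j = εν) := by
    intro S hS
    have hSK : ∏ i : Fin 6, (1 + εK (Set.powersetCard.ofFinEmbEquiv.symm S i) * s) =
        (1 + εμ * s) ^ 6 := congrFun hS true
    have hSF : ∏ i : Fin 6, (1 + εF (Set.powersetCard.ofFinEmbEquiv.symm S i) * r) =
        (1 + εν * r) ^ 6 := congrFun hS false
    have hKi := forall_eq_of_prod_one_add_eq (fun i => εK (Set.powersetCard.ofFinEmbEquiv.symm S i) * s)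
      (fun i => sign_mul_eq_or s (hεK _) hεμ) hsepK hSK
    have hFi := forall_eq_of_prod_one_add_eq (fun i => εF (Set.powersetCard.ofFinEmbEquiv.symm S i) * r)
      (fun i => sign_mul_eq_or r (hεF _) hεν) hsepF hSF
    apply Finset.eq_of_subset_of_card_le
    · intro j hj
      obtain ⟨i, rfl⟩ := (Set.powersetCard.mem_range_ofFinEmbEquiv_symm_iff_mem S j).2 hj
      exact Finset.mem_filter.2 ⟨Finset.mem_univ _, mul_right_cancel₀ hs0 (hKi i),
        mul_right_cancel₀ hr0 (hFi i)⟩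
    · rw [Set.powersetCard.card_eq]
      exact hcount _ _
  have hgood : {S : Set.powersetCard (Fin (4 * 6)) 6 | cS S = χ}.Subsingleton :=
    fun S hS S' hS' => Subtype.ext ((hkey S hS).trans (hkey S' hS').symm)
  -- joint eigenvectors lie in the span of the matching wedge vectors
  have hspan : ∀ c,
      c ∈ Module.End.eigenspace (complexBetti.map (𝟙 B + ψK).hom.hom.hom 6).hom ((1 + εμ * s) ^ 6) ⊓
        Module.End.eigenspace (complexBetti.map (𝟙 B + ψF).hom.hom.hom 6).hom ((1 + εν * r) ^ 6) →
      c ∈ Submodule.span ℂ (Bw '' {S | cS S = χ}) := by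
    intro c hc
    refine (forall_apply_eq_smul_iff_mem_span_image (P := Bool) Bw T cS hT χ c).1 ?_
    rintro (_ | _)
    · exact Module.End.mem_eigenspace_iff.1 hc.2
    · exact Module.End.mem_eigenspace_iff.1 hc.1
  rcases hgood.eq_empty_or_singleton with h0 | ⟨S₀, hS₀⟩
  · refine ⟨0, fun c hc => ?_⟩
    have h := hspan c hc
    rw [h0, Set.image_empty, Submodule.span_empty, Submodule.mem_bot] at h
    rw [h]
    exact Submodule.zero_mem _
  · refine ⟨Bw S₀, fun c hc => ?_⟩
    have h := hspan c hc
    rwa [hS₀, Set.image_singleton] at h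

end Wedge

end Summit.HodgeConjecture.HodgeConjecture.Theorems.WeilSixfoldsSqrtMinus7.RealQuadraticBaseChange

end
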